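import Summits.ValiantsHypothesis.ValiantsHypothesis.Theses.SymmetroidDescartes

/-!
# Crux `DerivedPencilRolleQuasi` (stmt-ValiantsHypothesis-18064) — line `sign-variation`
(exponent splitting to the semidefinite-distinct class + a SIGN-VARIATION quasi-Descartes rule)

Strategist line (planner-cstrat-stmt-ValiantsHypothesis-18064-0, 2026-08-17).  No lead line exists yet for this
crux; this skeleton is registered for the continuation lead to choose.  Card: `Lines/sign-variation.md`;
census: `STRATEGY-CENSUS.md` (same directory).

## Idea
1. **The Rolle term is vestigial.**  By replication collapse (block sums `⊕_j (F₁ + η_j X^{d₀} I)` leave the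
   derived pencil unchanged; census §F1) and by the triangular class (`Z₊(det ∂F) = 0` there; tree
   `triangular_bound_of_pencilBound`), any proof of the crux is a proof of the PURE quasi-polynomial bound
   `Z₊(det F) ≤ (K+1)^{A K} · 2^{(log₂ m + 2)^A}` and may as well take `C = 0`.  This line proves the crux with
   `C = 0`.
2. **Descartes' datum is the number of sign changes, not the number of terms.**  Exponent splitting
   (`stub_split`, shared verbatim with the sibling crux line `Cruxes/MatrixDescartes/Lines/sign_split.lean`):
   `S_l = S_l⁺ − S_l⁻`, `t^{d_l}(S_l⁺ − S_l⁻) ↦ u^{N d_l}S_l⁺ − u^{N d_l+1}S_l⁻` (`u^N = t`), `N → ∞`: every strict sign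
   alternation of `det F` survives, in a pencil of the SAME size with `≤ 2(K+1)` terms, PSD coefficients up to a sign
   word `σ`, pairwise distinct exponents; `stub_perturb` (shared verbatim) turns distinct positive roots into
   alternations at a factor 2.  In that class `V = signChanges σ ≤ 2K+1` is an honest induction parameter.
3. **The hard stub is term-count-free and binarisation-proof.**  The sibling's bilinear rule
   `Z₊ ≤ 2^{a(log m+1)(log(V+1)+1)}` is FALSE on paper (census §Strengthen S2: binarise the exponents of the
   Carstensen/Gajjar–Radhakrishnan bump ABP — `Z = 2^{Θ(log² n)}`, size `poly(n)`, only `O(log³ n)` distinct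
   monomials — then GKKP-symmetrise and split: `V = O(log³ n)` while `log Z = Θ(log² n) ≫ log n · log log n`).
   The repaired rule keeps the crux's own shape with `K ↦ V`:
   `SignVariationQuasiDescartes (SVQD): Z₊ ≤ (V+1)^{a V} · 2^{(log₂ m + 2)^a}` — Descartes-like in the number of
   SIGN CHANGES, quasi-polynomial in the size.  Rungs: `V = 0` trivial (`det` of a PSD pencil is `≡ 0` or
   zero-free on `(0,∞)`); `V = 1` a theorem on paper (`Z₊ ≤ m`: Loewner monotonicity of `t^{-e}F`, negative-index
   jumps; an indefinite pivot coefficient is tolerated — sibling census D6); `V = 2` OPEN and is the line's first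
   stuck goal: `Z₊ ≤ 2^{polylog m}` for `Σ_low t^dP_l − Σ_mid t^dN_l + Σ_high t^dQ_l` (PSD blocks, ANY number of
   terms) — a statement about the sublevel set `{x : M(x) ⋡ I}` of an exponentially convex matrix function.
   SVQD survives every family on file (binarised bumps need the `2^{(log m+2)^a}` factor with `a ≥ 2`; `m = 2`
   Descartes-sharp formats need `(V+1)^{aV}` with `a ≥ 1`; Vinnikov `K = 2`, staircase, compositions: inside).

Composition (proved below, `C = 0`, `A = 6a+1`): `Z₊(F) ≤ 2·(2K+2)^{a(2K+1)}·2^{(log₂m+2)^a}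
≤ (K+1)^{(6a+1)K}·2^{(log₂m+2)^{6a+1}}`.

Stubs (sorries live ONLY here): `stub_perturb` (L), `stub_split` (M), `stub_svqd` (open; hardest).
`DerivedPencilRolleQuasi_of` concludes the crux BY NAME.
-/

set_option linter.dupNamespace false
set_option linter.unusedVariables false

namespace Summit.ValiantsHypothesis.ValiantsHypothesis.Cruxes.DerivedPencilRolleQuasi.SignVariation

open Polynomial Matrix Finset
open scoped BigOperators

/-! ## Vocabulary (verbatim the sibling line's, so that stub statements are literally shared) -/

/-- The lacunary pencil `Σ_l X^{d_l} • S_l` (verbatim the crux's expression). -/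
noncomputable def pencil {K m : ℕ} (d : Fin K → ℕ) (S : Fin K → Matrix (Fin m) (Fin m) ℝ) :
    Matrix (Fin m) (Fin m) ℝ[X] :=
  ∑ l, (X : ℝ[X]) ^ d l • (S l).map C

/-- Number of distinct POSITIVE real roots of `det` of the pencil (`Z₊`, the crux's left-hand side). -/
noncomputable def posRootCount {K m : ℕ} (d : Fin K → ℕ) (S : Fin K → Matrix (Fin m) (Fin m) ℝ) : ℕ :=
  ((pencil d S).det.roots.toFinset.filter (fun t => 0 < t)).card

/-- Strict sign alternation of `det` of the pencil along positive test points `τ 0 < ⋯ < τ N`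
(the alternation datum of the tree lemma `le_card_posRoots_of_alternating`). -/
def Alternates {K m : ℕ} (d : Fin K → ℕ) (S : Fin K → Matrix (Fin m) (Fin m) ℝ)
    (N : ℕ) (τ : Fin (N + 1) → ℝ) : Prop :=
  StrictMono τ ∧ (∀ j, 0 < τ j) ∧
    ∀ j : Fin N, (pencil d S).det.eval (τ j.castSucc) * (pencil d S).det.eval (τ j.succ) < 0

/-- A signed family of matrices: `σ_l = true ↦ +A_l`, `false ↦ −A_l`. -/
noncomputable def signed {K m : ℕ} (σ : Fin K → Bool) (A : Fin K → Matrix (Fin m) (Fin m) ℝ) :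
    Fin K → Matrix (Fin m) (Fin m) ℝ :=
  fun l => (if σ l then (1 : ℝ) else -1) • A l

/-- Number of sign changes `V` of a sign word read in index order (= exponent order when the exponents
are strictly increasing): positions `i < K - 1` with `σ i ≠ σ (i+1)`. -/
noncomputable def signChanges {K : ℕ} (σ : Fin K → Bool) : ℕ :=
  (Finset.univ.filter fun i : Fin (K - 1) =>
    σ ⟨i.val, lt_of_lt_of_le i.isLt (Nat.sub_le K 1)⟩ ≠ σ ⟨i.val + 1, Nat.add_lt_of_lt_sub i.isLt⟩).card

theorem signChanges_le {K : ℕ} (σ : Fin K → Bool) : signChanges σ ≤ K - 1 := by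
  unfold signChanges
  exact (Finset.card_le_univ _).trans_eq (Fintype.card_fin _)

/-! ## The three stub statements -/

/-- (perturbation lemma; verbatim `Cruxes/MatrixDescartes/Lines/sign_split.lean`) if every SYMMETRIC pencil of
the format `(d, m)` has at most `B` strict sign alternations, then every symmetric pencil of that format has at
most `2B` distinct positive roots (roots of even multiplicity become sign changes of `det (F ± ε X^{d l₀} E)`,
`E ≻ 0` generic). -/
def PerturbToAlternation : Prop :=
  ∀ (K m : ℕ) (d : Fin K → ℕ) (B : ℕ),
    (∀ S : Fin K → Matrix (Fin m) (Fin m) ℝ, (∀ l, (S l).IsSymm) →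
        ∀ (N : ℕ) (τ : Fin (N + 1) → ℝ), Alternates d S N τ → N ≤ B) →
    ∀ S : Fin K → Matrix (Fin m) (Fin m) ℝ, (∀ l, (S l).IsSymm) → posRootCount d S ≤ 2 * B

/-- (exponent splitting; verbatim the sibling's) `N` strict sign alternations of a symmetric pencil of format
`(d, m)` force `N` distinct positive roots of SOME pencil of the same size `m` with at most `2K` terms, pairwise
distinct exponents and coefficients `± A_l`, `A_l ⪰ 0` (limit `F_N(t^{1/N}) → F(t)` + IVT). -/
def SplitToSemidefinite : Prop :=
  ∀ (K m : ℕ) (d : Fin K → ℕ) (S : Fin K → Matrix (Fin m) (Fin m) ℝ), (∀ l, (S l).IsSymm) →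
    ∀ (N : ℕ) (τ : Fin (N + 1) → ℝ), Alternates d S N τ →
      ∃ (K' : ℕ) (d' : Fin K' → ℕ) (σ : Fin K' → Bool) (A : Fin K' → Matrix (Fin m) (Fin m) ℝ),
        K' ≤ 2 * K ∧ StrictMono d' ∧ (∀ l, (A l).PosSemidef) ∧ N ≤ posRootCount d' (signed σ A)

/-- **C⁺ = the sign-variation quasi-Descartes rule (SVQD; NEW, the hard stub).**  For PSD `A_l`, strictly
increasing exponents and a sign word `σ` with `V` sign changes,
`Z₊(det Σ_l ± X^{d_l} A_l) ≤ (V+1)^{a V} · 2^{(log₂ m + 2)^a}`: the crux's own budget with the number of terms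
replaced by the number of SIGN CHANGES.  Term-count-free (hence immune to exponent binarisation, which kills
every `(log m)·(log K)` law); rungs `V = 0` trivial, `V = 1` a theorem (`Z₊ ≤ m`), `V = 2` open
(`Z₊ ≤ 2^{polylog m}` with any number of terms). -/
def SignVariationQuasiDescartes : Prop :=
  ∃ a : ℕ, ∀ (K m : ℕ) (d : Fin K → ℕ) (σ : Fin K → Bool) (A : Fin K → Matrix (Fin m) (Fin m) ℝ),
    StrictMono d → (∀ l, (A l).PosSemidef) →
      posRootCount d (signed σ A) ≤ (signChanges σ + 1) ^ (a * signChanges σ) * 2 ^ (Nat.log 2 m + 2) ^ a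

/-! ## Stubs (sorries live ONLY here) -/

/-- STUB (L): the perturbation lemma (local kernel-jet analysis at each root; generic positive definite
perturbation of one coefficient, both signs).  Shared with the sibling line `MatrixDescartes/sign-split`. -/
theorem stub_perturb : PerturbToAlternation := by
  sorry

/-- STUB (M): exponent splitting (spectral decomposition `S = S⁺ − S⁻`, merging equal exponents,
continuity of `det F_N(τ_j^{1/N})` in `N`, tree lemma `le_card_posRoots_of_alternating`).  Shared with the
sibling line. -/
theorem stub_split : SplitToSemidefinite := by
  sorry

/-- STUB (the hard one): the sign-variation quasi-Descartes rule. -/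
theorem stub_svqd : SignVariationQuasiDescartes := by
  sorry

/-! ## Glue (proved) -/

theorem two_le_pow_succ_self (K : ℕ) (hK : 1 ≤ K) : 2 ≤ (K + 1) ^ K := by
  calc 2 ≤ K + 1 := by omega
    _ = (K + 1) ^ 1 := (pow_one _).symm
    _ ≤ (K + 1) ^ K := Nat.pow_le_pow_right (by omega) hK

/-- The budget arithmetic of the composition: `2·(2K+2)^{a(2K+1)}·2^{x^a} ≤ (K+1)^{(6a+1)K}·2^{x^{6a+1}}`
for `x ≥ 2` (`x = log₂ m + 2`).  `K = 0`: the quasi-polynomial factor pays; `K ≥ 1`: `(2K+2) ≤ (K+1)²` and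
`2a(2K+1) ≤ 6aK`. -/
theorem budget_arith (a K x : ℕ) (hx : 2 ≤ x) :
    2 * ((2 * K + 2) ^ (a * (2 * K + 1)) * 2 ^ x ^ a) ≤
      (K + 1) ^ ((6 * a + 1) * K) * 2 ^ x ^ (6 * a + 1) := by
  have hx1 : 1 ≤ x := by omega
  have hxa : 1 ≤ x ^ a := Nat.one_le_pow _ _ (by omega)
  rcases Nat.eq_zero_or_pos K with hK | hK
  · subst hK
    have h2' : ∀ n : ℕ, n + 2 ≤ 2 ^ (n + 1) := by
      intro n
      induction n with
      | zero => norm_num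
      | succ n ih => rw [pow_succ]; omega
    have h2 : a + 2 ≤ 2 ^ (5 * a + 1) :=
      (h2' a).trans (Nat.pow_le_pow_right (by norm_num) (by omega))
    have hxp : 2 ^ (5 * a + 1) ≤ x ^ (5 * a + 1) := Nat.pow_le_pow_left hx _
    have key : 1 + a + x ^ a ≤ x ^ (6 * a + 1) := by
      have hsplit : x ^ (6 * a + 1) = x ^ a * x ^ (5 * a + 1) := by
        rw [← pow_add]; congr 1; ring
      rw [hsplit]
      have h3 : x ^ a * (a + 2) ≤ x ^ a * x ^ (5 * a + 1) :=
        Nat.mul_le_mul_left _ (h2.trans hxp)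
      have h4 : 1 + a + x ^ a ≤ x ^ a * (a + 2) := by nlinarith
      exact h4.trans h3
    simp only [mul_zero, zero_add, mul_one, pow_zero, one_mul]
    calc 2 * (2 ^ a * 2 ^ x ^ a) = 2 ^ (1 + a + x ^ a) := by
          rw [pow_add, pow_add, pow_one]; ring
      _ ≤ 2 ^ x ^ (6 * a + 1) := Nat.pow_le_pow_right (by norm_num) key
  · have hK1 : 1 ≤ K := hK
    have hbase : 2 * K + 2 ≤ (K + 1) ^ 2 := by nlinarith
    have h1 : (2 * K + 2) ^ (a * (2 * K + 1)) ≤ (K + 1) ^ (6 * a * K) := by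
      calc (2 * K + 2) ^ (a * (2 * K + 1)) ≤ ((K + 1) ^ 2) ^ (a * (2 * K + 1)) :=
            Nat.pow_le_pow_left hbase _
        _ = (K + 1) ^ (2 * (a * (2 * K + 1))) := by rw [← pow_mul]
        _ ≤ (K + 1) ^ (6 * a * K) := by
            apply Nat.pow_le_pow_right (by omega)
            nlinarith
    have h2 : 2 ^ x ^ a ≤ 2 ^ x ^ (6 * a + 1) :=
      Nat.pow_le_pow_right (by norm_num) (Nat.pow_le_pow_right hx1 (by omega))
    have h3 : 2 ≤ (K + 1) ^ K := two_le_pow_succ_self K hK1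
    calc 2 * ((2 * K + 2) ^ (a * (2 * K + 1)) * 2 ^ x ^ a)
        ≤ (K + 1) ^ K * ((K + 1) ^ (6 * a * K) * 2 ^ x ^ (6 * a + 1)) :=
          Nat.mul_le_mul h3 (Nat.mul_le_mul h1 h2)
      _ = (K + 1) ^ ((6 * a + 1) * K) * 2 ^ x ^ (6 * a + 1) := by
          rw [← mul_assoc, ← pow_add]; congr 2; ring

/-- **The transfer** (proved modulo the three stubs), with the crux UNFOLDED verbatim so that the only
theorem of this file whose conclusion is the crux by name is `DerivedPencilRolleQuasi_of`.
Constants: `C = 0` (the derived pencil is not used), `A = 6a + 1`. -/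
theorem derivedPencilRolleQuasi_of_stubs (h₂ : PerturbToAlternation) (h₃ : SplitToSemidefinite)
    (h₄ : SignVariationQuasiDescartes) :
    ∃ C A : ℕ, ∀ (m K : ℕ) (S : Fin (K + 1) → Matrix (Fin m) (Fin m) ℝ) (d : Fin (K + 1) → ℕ),
      (∀ l, (S l).IsSymm) → (∀ l, (S l).det ≠ 0) → StrictMono d →
        ((∑ l, (Polynomial.X : Polynomial ℝ) ^ d l • (S l).map Polynomial.C).det.roots.toFinset.filter
            (fun t => 0 < t)).card ≤
          C * ((∑ l : Fin K, (Polynomial.X : Polynomial ℝ) ^ (d l.succ - d 0 - 1) •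
            (((d l.succ - d 0 : ℕ) : ℝ) • S l.succ).map Polynomial.C).det.roots.toFinset.filter
              (fun t => 0 < t)).card + (K + 1) ^ (A * K) * 2 ^ (Nat.log 2 m + 2) ^ A := by
  obtain ⟨a, ha⟩ := h₄
  refine ⟨0, 6 * a + 1, fun m K S d hS hdet hd => ?_⟩
  -- the uniform alternation bound of the format `(d, m)` obtained from splitting + SVQD
  set x : ℕ := Nat.log 2 m + 2 with hx
  set B : ℕ := (2 * K + 2) ^ (a * (2 * K + 1)) * 2 ^ x ^ a with hB
  have hx2 : 2 ≤ x := by omega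
  have hsplitB : ∀ S' : Fin (K + 1) → Matrix (Fin m) (Fin m) ℝ, (∀ l, (S' l).IsSymm) →
      ∀ (N : ℕ) (τ : Fin (N + 1) → ℝ), Alternates d S' N τ → N ≤ B := by
    intro S' hS' N τ hA
    obtain ⟨K', d', σ, A', hK', hd', hA', hN⟩ := h₃ (K + 1) m d S' hS' N τ hA
    refine hN.trans ((ha K' m d' σ A' hd' hA').trans ?_)
    have hV : signChanges σ ≤ 2 * K + 1 := by
      have := signChanges_le σ
      omega
    have hV1 : signChanges σ + 1 ≤ 2 * K + 2 := by omega
    calc (signChanges σ + 1) ^ (a * signChanges σ) * 2 ^ (Nat.log 2 m + 2) ^ a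
        ≤ (2 * K + 2) ^ (a * (2 * K + 1)) * 2 ^ x ^ a := by
          apply Nat.mul_le_mul _ (le_refl _)
          calc (signChanges σ + 1) ^ (a * signChanges σ)
              ≤ (2 * K + 2) ^ (a * signChanges σ) := Nat.pow_le_pow_left hV1 _
            _ ≤ (2 * K + 2) ^ (a * (2 * K + 1)) :=
                Nat.pow_le_pow_right (by omega) (Nat.mul_le_mul_left a hV)
      _ = B := by rw [hB]
  -- distinct positive roots of the given pencil
  have hpos : posRootCount d S ≤ 2 * B := h₂ (K + 1) m d B hsplitB S hS
  -- the crux's left-hand side is `posRootCount d S` on the nose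
  show posRootCount d S ≤ 0 * _ + (K + 1) ^ ((6 * a + 1) * K) * 2 ^ (Nat.log 2 m + 2) ^ (6 * a + 1)
  rw [zero_mul, zero_add]
  exact hpos.trans (budget_arith a K x hx2)

/-- **The line's composition**: the crux, by name, from the stubs. -/
theorem DerivedPencilRolleQuasi_of :
    Summit.ValiantsHypothesis.ValiantsHypothesis.Theses.SymmetroidDescartes.DerivedPencilRolleQuasi :=
  derivedPencilRolleQuasi_of_stubs stub_perturb stub_split stub_svqd

end Summit.ValiantsHypothesis.ValiantsHypothesis.Cruxes.DerivedPencilRolleQuasi.SignVariation
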